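import Literature.MathematicalPhysics.QuantumFieldTheory.Balaban1983to89.B8Prop5UniqKLevel
import Literature.MathematicalPhysics.QuantumFieldTheory.Balaban1983to89.B8Prop5JoinSectELocal

/-!
# `Balaban1983to89.B8Prop5UniqSectE` — T. Bałaban, *Spaces of regular gauge field configurations on a lattice and gauge fixing conditions*,
# Commun. Math. Phys. **99** (1985) 75–102 [Balaban1985RegularSpaces] ("B8"), PROPOSITION 5 p. 94, THE UNIQUENESS CLAUSE (1.109) AT `k` LEVELS
# WITH THE SECT. E CORRECTION INSTANTIATED AND THE TOWER-LOCAL INVERSION ROUTE — the uniqueness twin of the join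
# `B8Prop5JoinSectELocal.hFP_kLevel_of_sectE_local'` («JOIN-C, local route»): `B8Prop5UniqKLevel.hFP_unique_of_cond179` with
# `H_c λ := −i·H′D′(u₁⁻¹, −iλ)` (Sect. E) and (1.29) ⇒ (1.79) for the inverse pair by `pub-ymgap-dag-n04-b`'s `B8Restr129InversionLocal`

statement-level skeleton of published theorems with citation tags; proofs where landed; nothing here is a claim about the
Yang–Mills mass gap

PDF held: `paper:balaban1985-cmp99-regular-spaces-gauge-fixing` (journal page = PDF page + 74); pp. 90, 94–97.  [3] = [Balaban1985Averaging]
(Prop. 10, (178)–(179) p. 45, (203)–(204), (208), (213)–(214) p. 50); [4] = [Balaban1985BackgroundPropagators] ((1.91)–(1.92) of B8).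

WHY THIS FILE (cell `pub-ymgap`, HUMAN RULING D-0062; dag-lead REACTIVATE №14 / REBALANCE №50; seat `pub-ymgap-dag-n04-b` g5).  The engine
`B8Prop5UniqKLevel.hFP_unique_of_cond179` proves Proposition 5's uniqueness (1.109) in the knit's currency for an ABSTRACT correction `H_c`
and with print's (1.79) «`Q′(u₁⁻¹, (e^{iλ′})⁻¹) = 0` on `𝔅_k`» as the input of each competitor.  The knit's socket speaks (1.29)
(`Restr129 L k Λs U₀ (u₁·v)`) and needs `H_c` INSTANTIATED by Sect. E — exactly as the existence side went from JOIN-B to JOIN-C.  This file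
does for uniqueness what `B8Prop5JoinSectELocal` did for existence: §1 supplies the tower-local CONVERSE (1.29) ⇒ (1.79) (the landed
`restr129_mul_inv_of_cond179_local` is (1.79) ⇒ (1.29)), §2 instantiates `H_c λ := −i·H′D′(u₁⁻¹, −iλ)` on the ¼α₄-ball
(`B8Prop5JoinSectE.sectE_exists` / `sectE_lipschitz`, chosen once) and derives the engine's converse-use hypothesis `h114q` from Sect. E's
(1.114) + the reading `hq` of the letter `Q′` on `𝔅_k` + its ZERO-EXTENSION law `hq0` off `𝔅_k`.

WHAT THIS FILE PROVES (kernel, 0 sorry, theorems only; `𝔸` a nontrivial C⋆-algebra, unitary data):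
* §1 **`cond179_of_restr129_mul_inv_local`** — (1.29) for `u₁·(e^{λ})⁻¹` ⇒ (1.79) `Q′(u₁⁻¹, e^{λ}) = 0` on `𝔅_k`, tower-local hypotheses only
  (unitary `Λ_j`-witnesses for `u₁`, (207) for `λ` on the towers, (1.33), r04's Prop-10 windows): at `y ∈ Λ_j`, with `w = e^{λ}u₁⁻¹`,
  `\overline{R₀w⁻¹}ʲ(y) = (\overline{R₀w}ʲ(y))⁻¹` (`uavg_inv_tower_of_witness` for the product witness `witness_mul_of207`) so (1.29) for
  `w⁻¹ = u₁e^{−λ}` gives `\overline{R₀w}ʲ(y) = 1`; `\overline{R₀u₁⁻¹}ʲ(y) = (\overline{R₀u₁}ʲ(y))⁻¹ = 1`; hence (178) `ũ′ʲ(y) = 1` and (208)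
  `Q′_j = log ũ′ʲ = log 1 = 0` — no log-domain condition in this direction; `cond179_gaugeExp_of_restr129_local` — the same read for
  `v = e^{iλ′}`: `Restr129 … (u₁·e^{iλ′}) ⇒ Cond179 … (e^{iλ′})⁻¹ u₁⁻¹`.
* §2 **`hFP_unique_of_sectE_local`** — PROPOSITION 5 (1.109) AT `k` LEVELS ON THE `Ω 0 = univ` SUB-FAMILY, SECT. E INSTANTIATED, LOCAL ROUTE:
  two site functions `λ′₁, λ′₂` in the `ρ`-ball of print's domain (sup everywhere, `Eb`-weighted gradients), each obeying `HFP`'s multiplier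
  clause and `Restr129 L k Λs U₀ (u₁·e^{iλ′ᵢ})`, COINCIDE.  Displayed: the [4] letters `g Δ q qs Aw c` with `g_left`, `c_left'` ([4] (3.25),
  left inverse of `C` in range form), readings `hΔ`/`hqs`/`hq` and the zero-extension law `hq0` of `Q′` off `𝔅_k`; `H′` of (1.91)–(1.92) with
  `hH0 hH1 hH2 hQH`; (1.101) `hG`, (1.98)R `hRbd`; the datum's tower-local regime AT `u₁` and the source `D*A` as in JOIN-C; JOIN-C's windows
  PLUS the two uniqueness windows `lE ≤ ½` (Lipschitz modulus of `H_c`) and `ρ + hE ≤ ¼α₄` (`hE = B′₀C′₂(α₃ + α₄)α₄` — print's c₃ = ρ).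
  NOT displayed (not needed for uniqueness): `g_right`, `c_right`, the Dirichlet-range and reality laws, `hHequiv`, [3]'s `hCequiv`.

HONEST SCOPE.  Composition over landed modules; nothing of [4], of Sect. E beyond n05-b's/n04-b's theorems, or of the contraction is proved
here.  CONSISTENCY NOTE for the knit: the zero-extension law `hq0` is print's «Q′λ = 0» read as a vector identity (needed for `RΔλ = Δλ`,
p. 92); a letters family that ALSO carries the existence side's full-space `c_right : ∀ φ, Q′G′²Q′*Cφ = φ` would be inconsistent (take `φ ≠ 0`
off `𝔅_k`) — the existence side must then read `c_right` in range form `∀ f, Q′G′²Q′*C(Q′f) = Q′f` (all `B8Eq195Linear` uses are of that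
form).  Count-neutral; N05 NOT discharged; nothing continuum / ℝ⁴ / OS / mass-gap / Clay.  Unit `pub-ymgap-dag-n04-b` (g5), 2026-08-26.
-/

noncomputable section

open NormedSpace Metric Set Filter Topology
open Complex (I)

namespace Literature.MathematicalPhysics.QuantumFieldTheory.Balaban1983to89.B8Prop5UniqSectE

open B7Prop1Explicit (e U1 expUnit val_inv_expUnit val_expUnit)
open B7Prop2Explicit (unitaryUnits mem_unitaryUnits unitaryUnits_le_U1 avgClosed_unitaryUnits AvgClosed C0 c2')
open B7Prop1Local (InBox pdevOn clampCfg)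
open B7Prop3Flat (expCfg c3)
open B7Eq78Linearization (conjR zdBlocking QprimeIter QprimeIter_smul)
open B7Eq167Flat (InLambda)
open B7Eq170Flat (cj cj_apply)
open B7Prop10General (C6 C4G utilG)
open B7Prop10Flat (one_le_C5 C4'_nonneg C5'_nonneg)
open B7Prop9Flat (C5')
open B7Eq214General (Cgen)
open B8Ineq130 (tlo thi tlo_zero thi_zero)
open B7Eq84Concrete (uavg)
open B7Eq92Concrete (mgauge)
open B8Eq119TwistedAxial (bgT InAx Restr129)
open B8Eq178Averages (util178 Qnl Cond179 restr129_iff_uavg utilG_eq_uavg_mul_inv util178_eq_utilG)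
open B8Eq1123Concrete (Cnl cj_smul_complex)
open B8Ineq125Concrete (C2p C2p_nonneg)
open B8Eq1117Concrete (XSpace)
open B8Eq1117KLevel (glev_on_towers_of_axial)
open B8DprimeKLevelLipschitz (smallness_prod)
open B8SectEInLambdaWitness (witness_unitary_of_glev witness_inv_of_unitary)
open B8Restr129InversionLocal (uavg_inv_tower_of_witness witness_mul_of207)
open B8Ineq132 (covDerivFwd covDeriv norm_conjR)
open B8Eq151V2Divergence (covDerivFwd_smul)
open B8Eq138LandauZd (covLap covDivB QT)
open B8Eq182Proof (gAd)
open B8Eq184Proof (gaugeExp)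
open B8Eq188Proof (frakF3)
open B8LambdaSpaceKLevel (wt wt_pos wt_nonneg lamSubK lamOf lamOf_sub norm_lamOf_le weight_mul_norm_covDerivFwd_le norm_cjDiff_lamOf_le
  norm_le_iff norm_sub_le_iff covDerivFwd_sub')
open B8Prop5ContractionKLevel (Bd2 Mc Kc)
open B8Prop5KLevelLetters (covLap_sub)
open B8Prop5JoinSectE (sectE_exists sectE_lipschitz cjDiff_le_of_weighted covLap_smul)
open B8Prop5GaugeParamKLevel (gpar_size)
open B8Prop5UniqKLevel (hFP_unique_of_cond179)

-- `Site` alone could resolve to the torus sites of `Setup.lean`; re-export the `ℤ^d` sites of `B7Prop1Explicit`.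
export B7Prop1Explicit (Site)

variable {d : ℕ} {𝔸 : Type*} [CStarAlgebra 𝔸] [Nontrivial 𝔸]

/-! ## §1 (1.29) for `u₁·(e^{λ})⁻¹` ⇒ (1.79) for the pair `(e^{λ}, u₁⁻¹)`, tower-local hypotheses only -/

section Local

variable {L k : ℕ} {Λ : ℕ → Set (Site d)} {U₀ : Site d → Fin d → 𝔸ˣ} {α₀ α₃ α₄ : ℝ} {lam : Site d → 𝔸} {u₁ : Site d → 𝔸ˣ}

/-- **(1.29) FOR `u₁·(e^{λ})⁻¹` ⇒ (1.79) `Q′(u₁⁻¹, e^{λ}) = 0` ON `𝔅_k`, TOWER-LOCAL HYPOTHESES ONLY** — the converse of this seat's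
`B8Restr129InversionLocal.restr129_mul_inv_of_cond179_local` (same regime: `u₁` with (1.29) and a UNITARY `Λ_j`-witness at every `(j, y ∈ Λ_j)`,
`U₀` unitary with (1.33) on the towers, (207) for `λ` on the towers, r04's Prop-10 windows at `(α₃, 4α₄)` and `2C₆(α₃ + 4α₄) < ½`).  At
`y ∈ Λ_j`, with `w = e^{λ}u₁⁻¹` (witness `witness_mul_of207` on `ũ⁻¹`): (1.29) for `u₁e^{−λ} = w⁻¹` reads `\overline{R₀w⁻¹}ʲ(y) = 1`, and
`\overline{R₀w⁻¹}ʲ(y) = (\overline{R₀w}ʲ(y))⁻¹` (`uavg_inv_tower_of_witness`), so `\overline{R₀w}ʲ(y) = 1`; `\overline{R₀u₁⁻¹}ʲ(y) =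
(\overline{R₀u₁}ʲ(y))⁻¹ = 1`; hence (178) `ũ′ʲ(y) = \overline{R₀w}ʲ(y)(\overline{R₀u₁⁻¹}ʲ(y))⁻¹ = 1` and (208)/(1.79) `Q′_j(u₁⁻¹, λ)(y) = log 1 = 0`.
[cite: Balaban1985RegularSpaces, (1.29) p.81, (1.78)–(1.79) p.90, p.94 («u = u′u₁»); Balaban1985Averaging, (178) p.45, (208) p.50, Prop. 10 p.50] -/
theorem cond179_of_restr129_mul_inv_local (hL : 2 ≤ L) (hL1 : 1 ≤ L) (hU₀ : ∀ x κ, U₀ x κ ∈ unitaryUnits 𝔸)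
    (hα : 0 < α₀) (hα3 : C0 d * α₀ ≤ 1 / 3) (hα2 : 2 * α₀ ≤ c2' d L) (hα₃ : 0 ≤ α₃) (hα₃' : α₃ ≤ 1 / 50) (hα₄ : 0 < α₄)
    (h33 : ∀ j, j ≤ k → ∀ y ∈ Λ j, pdevOn (tlo L y j) (thi L y j) U₀ < α₀ * (((L : ℝ) ^ j)⁻¹) ^ 2)
    (hwit : ∀ j, j ≤ k → ∀ y ∈ Λ j, ∃ ut : Site d → 𝔸ˣ, (∀ x, ut x ∈ unitaryUnits 𝔸) ∧
      InLambda L (clampCfg (tlo L y j) (thi L y j) U₀) ut j α₃ (((L : ℝ) ^ j)⁻¹) ∧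
      ∀ x : Site d, tlo L y j ≤ x → x ≤ thi L y j → u₁ x = ut x)
    (h177b : ∀ j, j ≤ k → ∀ y ∈ Λ j, ∀ x : Site d, InBox (tlo L y j) (thi L y j) x → ‖lam x‖ < α₄)
    (h177a : ∀ j, j ≤ k → ∀ y ∈ Λ j, ∀ (x : Site d) (κ : Fin d), InBox (tlo L y j) (thi L y j) x →
      InBox (tlo L y j) (thi L y j) (x + e κ) → ‖cj (U₀ x κ) (lam (x + e κ)) - lam x‖ < α₄ * ((L : ℝ) ^ j)⁻¹)
    (hs₁ : 10 * C6 d * (4 * α₄) ≤ 1) (hs₂ : 3000 * ((d : ℝ) + 1) * L * (4 * α₄) ≤ 1) (hs₃ : C4G d L * (α₀ + α₃ + 4 * α₄) ≤ 1)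
    (hs₄ : 1024 * ((d : ℝ) + 1) * ((d : ℝ) + 4) * L ^ 2 * α₀ ≤ 1) (hs₅ : 32 * ((d : ℝ) + 1) ^ 2 * C6 d * L ^ 2 * α₀ ≤ 1)
    (hs₆ : 16 * d * C5' d * C6 d * (L : ℝ) ^ 2 * α₀ ≤ 1)
    (hprod : 2 * C6 d * (α₃ + 4 * α₄) < 1 / 2)
    (h129 : Restr129 L k Λ U₀ u₁) (h129' : Restr129 L k Λ U₀ (u₁ * (fun x => expUnit (lam x))⁻¹)) :
    Cond179 L k Λ U₀ (fun x => expUnit (lam x)) u₁⁻¹ := by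
  have hG := avgClosed_unitaryUnits d L (𝔸 := 𝔸)
  have hC6 : (2 : ℝ) ≤ C6 d := by unfold C6; linarith [one_le_C5 (d := d)]
  have hα₃h : α₃ < 1 / 2 := by linarith
  have hα₃q : α₃ ≤ 1 / 4 := by linarith
  intro j hj y hy
  obtain ⟨ut, hun, hW, hag⟩ := hwit j hj y hy
  have hy₀ : tlo L y 0 ≤ y := by rw [tlo_zero]
  have hy₀' : y ≤ thi L y 0 := by rw [thi_zero]
  -- the witness `ũ⁻¹` for `u₁⁻¹` and the product witness for `w = e^{λ}·u₁⁻¹`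
  obtain ⟨uti, hWi, hagi⟩ := witness_inv_of_unitary hL hU₀ hα hα3 hα2 (h33 j hj y hy) hL1 hα₃ hα₃q hun hW hag
  obtain ⟨wt, hWw, hagw⟩ := witness_mul_of207 hL hG hU₀ hα hα3 hα2 (h33 j hj y hy) hL1 hWi hagi hα₄ (h177b j hj y hy) (h177a j hj y hy)
    hα₃ hα₃' hs₁ hs₂ hs₃ hs₄ hs₅ hs₆
  -- `u₁·(e^{λ})⁻¹ = w⁻¹`
  have hinv : u₁ * (fun x => expUnit (lam x))⁻¹ = ((fun x => expUnit (lam x)) * u₁⁻¹)⁻¹ := by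
    rw [mul_inv_rev, inv_inv]
  have h1 := uavg_inv_tower_of_witness (u := (fun x => expUnit (lam x)) * u₁⁻¹) hL1 (by positivity) hprod hWw hagw (m := j) (n := 0)
    (by omega) y hy₀ hy₀'
  have h2 := uavg_inv_tower_of_witness (u := u₁) hL1 hα₃ hα₃h hW hag (m := j) (n := 0) (by omega) y hy₀ hy₀'
  have h129y : uavg L U₀ u₁ j y = 1 := (restr129_iff_uavg L k Λ U₀ u₁).1 h129 j hj y hy
  have h129y' : uavg L U₀ (u₁ * (fun x => expUnit (lam x))⁻¹) j y = 1 := (restr129_iff_uavg L k Λ U₀ _).1 h129' j hj y hy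
  -- `\overline{R₀w}ʲ(y) = 1`
  have hw : uavg L U₀ ((fun x => expUnit (lam x)) * u₁⁻¹) j y = 1 := by
    rw [hinv, h1, inv_eq_one] at h129y'
    exact h129y'
  -- (178): `ũ′ʲ(y) = \overline{R₀w}ʲ(y)·(\overline{R₀u₁⁻¹}ʲ(y))⁻¹ = 1`
  have hutil : utilG L U₀ (fun x => expUnit (lam x)) u₁⁻¹ j y = 1 := by
    have h := congrFun (utilG_eq_uavg_mul_inv L U₀ (fun x => expUnit (lam x)) u₁⁻¹ j) y
    rw [hw, h2, h129y, inv_one, inv_one, one_mul] at h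
    exact h
  -- (208)/(1.79): `Q′_j = log ũ′ʲ = log 1 = 0`
  show MatrixLog.mlog (util178 L U₀ (fun x => expUnit (lam x)) u₁⁻¹ j y) = 0
  rw [util178_eq_utilG, hutil, Units.val_one, MatrixLog.mlog_one]

/-- **The same read for `v = e^{iλ′}`**: `(e^{iλ′})⁻¹ = e^{−iλ′}` pointwise, so (1.29) for `u₁·e^{iλ′}` gives (1.79) for the inverse pair
`((e^{iλ′})⁻¹, u₁⁻¹)` — the input `h179` of `B8Prop5UniqKLevel.isFixedPoint_of_cond179` — from (207) for `−iλ′` on the towers.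
[cite: Balaban1985RegularSpaces, (1.29) p.81, (1.79) p.90, (1.107) p.94] -/
theorem cond179_gaugeExp_of_restr129_local (hL : 2 ≤ L) (hL1 : 1 ≤ L) (hU₀ : ∀ x κ, U₀ x κ ∈ unitaryUnits 𝔸)
    (hα : 0 < α₀) (hα3 : C0 d * α₀ ≤ 1 / 3) (hα2 : 2 * α₀ ≤ c2' d L) (hα₃ : 0 ≤ α₃) (hα₃' : α₃ ≤ 1 / 50) (hα₄ : 0 < α₄)
    (h33 : ∀ j, j ≤ k → ∀ y ∈ Λ j, pdevOn (tlo L y j) (thi L y j) U₀ < α₀ * (((L : ℝ) ^ j)⁻¹) ^ 2)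
    (hwit : ∀ j, j ≤ k → ∀ y ∈ Λ j, ∃ ut : Site d → 𝔸ˣ, (∀ x, ut x ∈ unitaryUnits 𝔸) ∧
      InLambda L (clampCfg (tlo L y j) (thi L y j) U₀) ut j α₃ (((L : ℝ) ^ j)⁻¹) ∧
      ∀ x : Site d, tlo L y j ≤ x → x ≤ thi L y j → u₁ x = ut x)
    {lam' : Site d → 𝔸}
    (h177b : ∀ j, j ≤ k → ∀ y ∈ Λ j, ∀ x : Site d, InBox (tlo L y j) (thi L y j) x → ‖((-I) • lam') x‖ < α₄)
    (h177a : ∀ j, j ≤ k → ∀ y ∈ Λ j, ∀ (x : Site d) (κ : Fin d), InBox (tlo L y j) (thi L y j) x →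
      InBox (tlo L y j) (thi L y j) (x + e κ) → ‖cj (U₀ x κ) (((-I) • lam') (x + e κ)) - ((-I) • lam') x‖ < α₄ * ((L : ℝ) ^ j)⁻¹)
    (hs₁ : 10 * C6 d * (4 * α₄) ≤ 1) (hs₂ : 3000 * ((d : ℝ) + 1) * L * (4 * α₄) ≤ 1) (hs₃ : C4G d L * (α₀ + α₃ + 4 * α₄) ≤ 1)
    (hs₄ : 1024 * ((d : ℝ) + 1) * ((d : ℝ) + 4) * L ^ 2 * α₀ ≤ 1) (hs₅ : 32 * ((d : ℝ) + 1) ^ 2 * C6 d * L ^ 2 * α₀ ≤ 1)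
    (hs₆ : 16 * d * C5' d * C6 d * (L : ℝ) ^ 2 * α₀ ≤ 1)
    (hprod : 2 * C6 d * (α₃ + 4 * α₄) < 1 / 2)
    (h129 : Restr129 L k Λ U₀ u₁) (h129' : Restr129 L k Λ U₀ (u₁ * gaugeExp lam')) :
    Cond179 L k Λ U₀ (gaugeExp lam')⁻¹ u₁⁻¹ := by
  have hfun : (gaugeExp lam')⁻¹ = fun x => expUnit (((-I) • lam') x) := by
    funext x
    rw [Pi.inv_apply, gaugeExp, val_inv_expUnit, Pi.smul_apply, neg_smul]
  have hfun' : (fun x => expUnit (((-I) • lam') x))⁻¹ = gaugeExp lam' := by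
    rw [← hfun, inv_inv]
  rw [hfun]
  exact cond179_of_restr129_mul_inv_local hL hL1 hU₀ hα hα3 hα2 hα₃ hα₃' hα₄ h33 hwit h177b h177a hs₁ hs₂ hs₃ hs₄ hs₅ hs₆ hprod h129
    (by rw [hfun']; exact h129')

end Local

/-! ## §2 Proposition 5's uniqueness (1.109) at `k` levels with Sect. E's correction instantiated, local route -/

section SectE

variable {L k : ℕ} {η : ℝ} {Ω Λs : ℕ → Set (Site d)} {Eb : ℕ → Set (Site d × Fin d)} {U₀ : Site d → Fin d → 𝔸ˣ}
  {A : Site d → Fin d → 𝔸} {u₁ : Site d → 𝔸ˣ}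

omit [Nontrivial 𝔸] in
/-- `‖(−i)·a‖ = ‖a‖`. [folklore] -/
private theorem norm_negI_smul (a : 𝔸) : ‖(-I) • a‖ = ‖a‖ := by
  rw [norm_smul, norm_neg, Complex.norm_I, one_mul]

/-- **PROPOSITION 5, THE UNIQUENESS CLAUSE (1.109), AT `k` LEVELS ON THE `Ω 0 = univ` SUB-FAMILY — SECT. E INSTANTIATED, TOWER-LOCAL INVERSION
ROUTE** (the uniqueness twin of `B8Prop5JoinSectELocal.hFP_kLevel_of_sectE_local'`).  The engine `B8Prop5UniqKLevel.hFP_unique_of_cond179` run with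
the correction `H_c λ := −i·H′D′(u₁⁻¹, −iλ)` of route (a″) (`D′` = THE solution of (1.117) on the ¼α₄-ball, chosen once:
`B8Prop5JoinSectE.sectE_exists` / `sectE_lipschitz`; sizes `hE = B′₀C′₂(α₃ + α₄)α₄`, `hE₂`, moduli `lE = 4B′₀C′₂(α₃ + 2α₄)`, `lE₂`), its
converse-use hypothesis `h114q` DERIVED from Sect. E's (1.114) + the reading `hq` of `Q′` on `𝔅_k` + the zero-extension law `hq0` off `𝔅_k`,
and each competitor's (1.79) DERIVED from its (1.29) by §1 (witnesses for `u₁` from the datum's (1.34)/(1.29):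
`B8SectEInLambdaWitness.witness_unitary_of_glev` ∘ `B8Eq1117KLevel.glev_on_towers_of_axial`).  DISPLAYED: the letters `g Δ q qs Aw c` with
`g_left`, `c_left'`, `hΔ`, `hqs`, `hq`, `hq0`; `H′` with (1.92) `hH0 hH1 hH2` and (1.91) `hQH`; (1.101) `hG`, (1.98)R `hRbd`; the datum's
tower-local regime AT `u₁` ((1.33) `h33`, (1.69) `h69`, `hBu`, `hP`, (1.34) `hAx`, (1.29) `h129`), tower bonds in `Eb j`, the source `D*A`
(`hDA`, `hA`); JOIN-C's windows (`hsmall … hprod8`, `ha₁' hb₁' hθ`, (1.103) `h103`, (1.106) `h106`) PLUS the two uniqueness windows `hlE : lE ≤ ½`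
and `hρ : ρ + hE ≤ ¼α₄`.  CLAIM: two site functions `λ′₁, λ′₂` with `‖λ′ᵢ‖ ≤ ρ` everywhere and `(Lʲη)‖D^η_{U₀}λ′ᵢ‖ ≤ ρ` on the `Eb j`, each
obeying `HFP`'s multiplier clause and `Restr129 L k Λs U₀ (u₁·e^{iλ′ᵢ})`, ARE EQUAL.
[cite: Balaban1985RegularSpaces, Prop. 5 (1.109) p.94, (1.113)–(1.121) pp.95–97, (1.92) p.91, (1.95)–(1.106) pp.92–94, (1.78)–(1.79) p.90,
(1.29) p.81; Balaban1985Averaging, Prop. 10 p.50, (178) p.45] -/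
theorem hFP_unique_of_sectE_local (hL : 2 ≤ L) (hη : 0 < η) (hU₀ : ∀ x κ, U₀ x κ ∈ unitaryUnits 𝔸) (hΩ0 : Ω 0 = Set.univ)
    (hEbΩ : ∀ j, j ≤ k → ∀ x ∈ Ω j, ∀ μ : Fin d, (x, μ) ∈ Eb j ∧ (x - e μ, μ) ∈ Eb j)
    (hEbT : ∀ j, j ≤ k → ∀ y ∈ Λs j, ∀ (x : Site d) (κ : Fin d), InBox (tlo L y j) (thi L y j) x →
      InBox (tlo L y j) (thi L y j) (x + e κ) → (x, κ) ∈ Eb j)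
    -- letters of [4]
    (g Δ : (Site d → 𝔸) →ₗ[ℂ] (Site d → 𝔸)) (q : (Site d → 𝔸) →ₗ[ℂ] (ℕ → Site d → 𝔸)) (qs : (ℕ → Site d → 𝔸) →ₗ[ℂ] (Site d → 𝔸))
    (Aw c : (ℕ → Site d → 𝔸) →ₗ[ℂ] (ℕ → Site d → 𝔸))
    (g_left : ∀ x, g (Δ x + qs (Aw (q x))) = x) (c_left' : ∀ φ, qs (c (q (g (g (qs φ))))) = qs φ)
    (hΔ : ∀ (f : Site d → 𝔸), ∀ x ∈ Ω 0, Δ f x = covLap η U₀ ((Ω 0).indicator f) x)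
    (hqs : ∀ (μ : ℕ → Site d → 𝔸), ∀ x ∈ Ω 0, qs μ x = QT L k Λs U₀ μ x)
    (hq : ∀ (f : Site d → 𝔸) (j : ℕ), j ≤ k → ∀ y ∈ Λs j, q f j y = QprimeIter (zdBlocking d L) (bgT L U₀) j f y)
    (hq0 : ∀ (f : Site d → 𝔸) (j : ℕ) (y : Site d), ¬ (j ≤ k ∧ y ∈ Λs j) → q f j y = 0)
    -- the letter H′ of [4] ((1.91)–(1.92)) and the Sect. E / local-inversion regime (tower-local, everything AT u₁)
    (H' : XSpace d k 𝔸 →ₗ[ℂ] (Site d → 𝔸)) {B : Site d → Fin d → 𝔸} {α₀ αP α₄ cB B₀' B₂' : ℝ}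
    (hα : 0 < α₀) (hα3 : C0 d * α₀ ≤ 1 / 3) (hα4 : 4 * α₀ ≤ c2' d L) (hcB : 0 ≤ cB) (hα₄ : 0 < α₄) (hB : 0 < B₀') (hB₂ : 0 ≤ B₂')
    (h33 : ∀ j, j ≤ k → ∀ y ∈ Λs j, pdevOn (tlo L y j) (thi L y j) U₀ < α₀ * (((L : ℝ) ^ j)⁻¹) ^ 2)
    (h69 : ∀ j, j ≤ k → ∀ y ∈ Λs j, ∀ (x : Site d) (κ : Fin d), InBox (tlo L y j) (thi L y j) x →
      InBox (tlo L y j) (thi L y j) (x + e κ) → ‖B x κ‖ ≤ cB * ((L : ℝ) ^ j)⁻¹)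
    (hd : 1 ≤ d) (hαP : 0 < αP) (hαP3 : C0 d * αP ≤ 1 / 3) (hαP2 : 2 * αP ≤ c2' d L)
    (hBu : ∀ (x : Site d) (κ : Fin d), expCfg B x κ ∈ unitaryUnits 𝔸)
    (hP : ∀ j, j ≤ k → ∀ y ∈ Λs j, pdevOn (tlo L y j) (thi L y j) (expCfg B * U₀) < αP * (((L : ℝ) ^ j)⁻¹) ^ 2)
    (hAx : InAx L k Λs U₀ (mgauge U₀ u₁ (expCfg B) * U₀)) (h129 : Restr129 L k Λs U₀ u₁)
    (hH0 : ∀ (X : XSpace d k 𝔸) (x : Site d), ‖H' X x‖ ≤ B₀' * ‖X‖)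
    (hH1 : ∀ j, j ≤ k → ∀ (X : XSpace d k 𝔸), ∀ p ∈ Eb j, wt L η j * ‖covDerivFwd η U₀ p.2 (H' X) p.1‖ ≤ B₀' * ‖X‖)
    (hH2 : ∀ X : XSpace d k 𝔸, Bd2 L η k Ω (covLap η U₀ (H' X)) (B₂' * ‖X‖))
    (hQH : ∀ (Y : XSpace d k 𝔸) (j : ℕ) (hj : j ≤ k) (y : Site d), y ∈ Λs j →
      QprimeIter (zdBlocking d L) (bgT L U₀) j (H' Y) y = Y (⟨j, Nat.lt_succ_of_le hj⟩, y))
    (hsmall : Real.exp (4 * (800 * ((d : ℝ) + 1) ^ 2 * ((d : ℝ) + 4)) * α₀) * (1 + 8 * (131072 * ((d : ℝ) + 1) ^ 2) * cB) ≤ 2)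
    (hc₃ : 2 * cB ≤ c3 d L) (hsc : 2048 * (d : ℝ) * cB ≤ 1) (hα₃' : 40 * d * cB ≤ 1 / 200)
    (hs₁ : 200 * C6 d * (2 * α₄) ≤ 1) (hs₂ : 12000 * ((d : ℝ) + 1) * L * (2 * α₄) ≤ 1)
    (hs₃ : C4G d L * (α₀ + 40 * d * cB + 4 * (2 * α₄)) ≤ 1)
    (hs₄ : 1024 * ((d : ℝ) + 1) * ((d : ℝ) + 4) * L ^ 2 * α₀ ≤ 1) (hs₅ : 32 * ((d : ℝ) + 1) ^ 2 * C6 d * L ^ 2 * α₀ ≤ 1)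
    (hs₆ : 16 * d * C5' d * C6 d * (L : ℝ) ^ 2 * α₀ ≤ 1) (hs₇ : 8 * d * C6 d * L * α₀ ≤ 1)
    (hsm : 40 * d * cB + α₄ ≤ 1 / (4 * B₀' * (2 * C2p d))) (hprod8 : 2 * C6 d * (40 * d * cB + 4 * α₄) ≤ 1 / 8)
    -- the Sect. E sizes of H_c (named, so that the windows below read)
    {hE hE₂ lE lE₂ : ℝ} (hE_def : hE = B₀' * (C2p d * (40 * d * cB + α₄) * α₄)) (hE₂_def : hE₂ = B₂' * (C2p d * (40 * d * cB + α₄) * α₄))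
    (lE_def : lE = B₀' * (4 * C2p d * (40 * d * cB + 2 * α₄))) (lE₂_def : lE₂ = B₂' * (4 * C2p d * (40 * d * cB + 2 * α₄)))
    -- JOIN-B's letters G′, R, the datum, and its windows at these sizes; the two uniqueness windows
    {BG BR cA cDA ρ : ℝ} (hBG : 0 ≤ BG) (hBR : 0 ≤ BR) (hcA : 0 ≤ cA) (hcA' : cA ≤ 1 / 13) (hcDA : 0 ≤ cDA)
    (ha₁' : α₄ / 4 + hE ≤ 1 / 24) (hb₁' : α₄ / 4 + hE ≤ 1 / 140) (hθ : 10 * (α₄ / 4 + hE) * BR ≤ 1 / 2)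
    (hlE : lE ≤ 1 / 2) (hρ : ρ + hE ≤ α₄ / 4)
    (hG : ∀ (f : Site d → 𝔸) (m : ℝ), 0 ≤ m → Bd2 L η k Ω f m →
      (∀ x, ‖g f x‖ ≤ BG * m) ∧ ∀ j, j ≤ k → ∀ p ∈ Eb j, wt L η j * ‖covDerivFwd η U₀ p.2 (g f) p.1‖ ≤ BG * m)
    (hRbd : ∀ (f : Site d → 𝔸) (m : ℝ), 0 ≤ m → Bd2 L η k Ω f m → Bd2 L η k Ω (f - g (qs (c (q (g f))))) (BR * m))
    (hDA : Bd2 L η k Ω (fun y => covDivB η U₀ A y) cDA)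
    (hA : ∀ j, j ≤ k → ∀ x ∈ Ω j, ∀ μ : Fin d,
      wt L η j * ‖A x μ‖ ≤ cA ∧ wt L η j * ‖conjR (U₀ (x - e μ) μ)⁻¹ (A (x - e μ) μ)‖ ≤ cA)
    (h103 : BG * Mc d BR (α₄ / 4 + hE) cA hE₂ cDA ≤ α₄ / 4)
    (h106 : BG * Kc d BR (α₄ / 4 + hE) cA hE₂ cDA lE₂ (1 + lE) (1 + lE) ≤ 1 / 2)
    -- the two solutions
    {lam₁ lam₂ : Site d → 𝔸}
    (hl₁ : ∀ x, ‖lam₁ x‖ ≤ ρ) (hD₁ : ∀ j, j ≤ k → ∀ p ∈ Eb j, wt L η j * ‖covDerivFwd η U₀ p.2 lam₁ p.1‖ ≤ ρ)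
    (hmult₁ : ∃ μ : ℕ → Site d → 𝔸, ∀ x ∈ Ω 0,
      covLap η U₀ ((Ω 0).indicator fun y => covDivB η U₀ A y + covLap η U₀ lam₁ y +
        ((conjR (gaugeExp lam₁ y)⁻¹ (covDivB η U₀ A y) - covDivB η U₀ A y) +
          (gAd (covLap η U₀ lam₁ y) (lam₁ y) - covLap η U₀ lam₁ y) + ∑ μ, frakF3 η U₀ lam₁ A y μ)) x = QT L k Λs U₀ μ x)
    (h129₁ : Restr129 L k Λs U₀ (u₁ * gaugeExp lam₁))
    (hl₂ : ∀ x, ‖lam₂ x‖ ≤ ρ) (hD₂ : ∀ j, j ≤ k → ∀ p ∈ Eb j, wt L η j * ‖covDerivFwd η U₀ p.2 lam₂ p.1‖ ≤ ρ)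
    (hmult₂ : ∃ μ : ℕ → Site d → 𝔸, ∀ x ∈ Ω 0,
      covLap η U₀ ((Ω 0).indicator fun y => covDivB η U₀ A y + covLap η U₀ lam₂ y +
        ((conjR (gaugeExp lam₂ y)⁻¹ (covDivB η U₀ A y) - covDivB η U₀ A y) +
          (gAd (covLap η U₀ lam₂ y) (lam₂ y) - covLap η U₀ lam₂ y) + ∑ μ, frakF3 η U₀ lam₂ A y μ)) x = QT L k Λs U₀ μ x)
    (h129₂ : Restr129 L k Λs U₀ (u₁ * gaugeExp lam₂)) :
    lam₁ = lam₂ := by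
  have hL1 : 1 ≤ L := le_trans (by norm_num) hL
  have hC2 : 0 ≤ C2p d := C2p_nonneg d
  have hα₃ : (0 : ℝ) ≤ 40 * d * cB := by positivity
  have hhE : 0 ≤ hE := by rw [hE_def]; positivity
  have hhE₂ : 0 ≤ hE₂ := by rw [hE₂_def]; positivity
  have hlE0 : 0 ≤ lE := by rw [lE_def]; positivity
  have hlE₂ : 0 ≤ lE₂ := by rw [lE₂_def]; positivity
  have hb₁ : 0 < α₄ / 4 + hE := add_pos_of_pos_of_nonneg (by positivity) hhE
  have hρ0 : 0 ≤ ρ := (norm_nonneg _).trans (hl₁ 0)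
  -- THE solution map D′(u₁⁻¹, −i·) on the ¼α₄-ball, chosen once (reality not needed)
  have key : ∀ lam : Site d → 𝔸, ∃ X : XSpace d k 𝔸, ∀ s : lamSubK η U₀ L k Eb, lamOf s = lam → ‖s‖ ≤ α₄ / 4 →
      ‖X‖ ≤ α₄ / (2 * B₀') ∧ ‖X‖ ≤ C2p d * (40 * d * cB + α₄) * α₄ ∧
      (∀ (j : ℕ) (hj : j ≤ k) (y : Site d), y ∉ Λs j → X (⟨j, Nat.lt_succ_of_le hj⟩, y) = 0) ∧
      (∀ (j : ℕ) (hj : j ≤ k) (y : Site d), y ∈ Λs j →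
        Cnl L U₀ u₁⁻¹ j ((-I) • lamOf s - H' X) y = X (⟨j, Nat.lt_succ_of_le hj⟩, y)) ∧
      ∀ (j : ℕ), j ≤ k → ∀ y ∈ Λs j,
        Qnl L U₀ (fun x => expUnit (((-I) • lamOf s - H' X) x)) u₁⁻¹ j y = QprimeIter (zdBlocking d L) (bgT L U₀) j ((-I) • lamOf s) y := by
    intro lam
    by_cases h : ∃ s : lamSubK η U₀ L k Eb, lamOf s = lam ∧ ‖s‖ ≤ α₄ / 4
    · obtain ⟨s, rfl, hs⟩ := h
      obtain ⟨X, hX⟩ := sectE_exists hL hη hU₀ H' hα hα3 hα4 hcB hα₄ hB h33 h69 hd hαP hαP3 hαP2 hBu hP hAx h129 hEbT hH0 hH1 hQH hsmall hc₃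
        hsc hα₃' hs₁ hs₂ hs₃ hs₄ hs₅ hs₆ hs₇ hsm s hs
      refine ⟨X, fun t ht _ => ?_⟩
      rw [B8LambdaSpaceKLevel.ext_of_lamOf ht]
      exact hX
    · exact ⟨0, fun s h1 h2 => absurd ⟨s, h1, h2⟩ h⟩
  choose Dp hDp' using key
  have hDp := fun (s : lamSubK η U₀ L k Eb) (hs : ‖s‖ ≤ α₄ / 4) => hDp' (lamOf s) s rfl hs
  have hDpL : ∀ s t : lamSubK η U₀ L k Eb, ‖s‖ ≤ α₄ / 4 → ‖t‖ ≤ α₄ / 4 →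
      ‖Dp (lamOf s) - Dp (lamOf t)‖ ≤ 4 * C2p d * (40 * d * cB + 2 * α₄) * ‖s - t‖ := fun s t hs ht =>
    sectE_lipschitz hL hη hU₀ H' hα hα3 hα4 hcB hα₄ hB h33 h69 hd hαP hαP3 hαP2 hBu hP hAx h129 hEbT hH0 hH1 hsmall hc₃ hsc hα₃' hs₁ hs₂
      hs₃ hs₄ hs₅ hs₆ hs₇ hsm s t hs ht (hDp s hs).1 (hDp t ht).1 (hDp s hs).2.2.1 (hDp s hs).2.2.2.1 (hDp t ht).2.2.1 (hDp t ht).2.2.2.1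
  -- sizes of D′ and of its differences, multiplied by the (1.92) constants
  have hbdX : ∀ s : lamSubK η U₀ L k Eb, ‖s‖ ≤ α₄ / 4 → B₀' * ‖Dp (lamOf s)‖ ≤ hE := fun s hs => by
    rw [hE_def]; exact mul_le_mul_of_nonneg_left (hDp s hs).2.1 hB.le
  have hbdX₂ : ∀ s : lamSubK η U₀ L k Eb, ‖s‖ ≤ α₄ / 4 → B₂' * ‖Dp (lamOf s)‖ ≤ hE₂ := fun s hs => by
    rw [hE₂_def]; exact mul_le_mul_of_nonneg_left (hDp s hs).2.1 hB₂
  have hbdL : ∀ s t : lamSubK η U₀ L k Eb, ‖s‖ ≤ α₄ / 4 → ‖t‖ ≤ α₄ / 4 → B₀' * ‖Dp (lamOf s) - Dp (lamOf t)‖ ≤ lE * ‖s - t‖ :=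
    fun s t hs ht => by
    rw [lE_def, mul_assoc]; exact mul_le_mul_of_nonneg_left (hDpL s t hs ht) hB.le
  have hbdL₂ : ∀ s t : lamSubK η U₀ L k Eb, ‖s‖ ≤ α₄ / 4 → ‖t‖ ≤ α₄ / 4 → B₂' * ‖Dp (lamOf s) - Dp (lamOf t)‖ ≤ lE₂ * ‖s - t‖ :=
    fun s t hs ht => by
    rw [lE₂_def, mul_assoc]; exact mul_le_mul_of_nonneg_left (hDpL s t hs ht) hB₂
  have hsubH : ∀ s t : lamSubK η U₀ L k Eb, (-I) • H' (Dp (lamOf s)) - (-I) • H' (Dp (lamOf t)) = (-I) • H' (Dp (lamOf s) - Dp (lamOf t)) :=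
    fun s t => by rw [map_sub, smul_sub]
  -- the six binders of the engine for `H_c λ := −i·H′D′(u₁⁻¹, −iλ)`
  have hc0 : ∀ s : lamSubK η U₀ L k Eb, ‖s‖ ≤ α₄ / 4 → ∀ x, ‖((-I) • H' (Dp (lamOf s))) x‖ ≤ hE := fun s hs x => by
    rw [Pi.smul_apply, norm_negI_smul]; exact (hH0 _ x).trans (hbdX s hs)
  have hc1 : ∀ s : lamSubK η U₀ L k Eb, ‖s‖ ≤ α₄ / 4 → ∀ j, j ≤ k → ∀ p ∈ Eb j,
      wt L η j * ‖covDerivFwd η U₀ p.2 ((-I) • H' (Dp (lamOf s))) p.1‖ ≤ hE := fun s hs j hj p hp => by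
    rw [covDerivFwd_smul, norm_negI_smul]; exact (hH1 j hj _ p hp).trans (hbdX s hs)
  have hc2 : ∀ s : lamSubK η U₀ L k Eb, ‖s‖ ≤ α₄ / 4 → Bd2 L η k Ω (covLap η U₀ ((-I) • H' (Dp (lamOf s)))) hE₂ :=
    fun s hs j hj x hx => by
    rw [covLap_smul, norm_negI_smul]; exact (hH2 _ j hj x hx).trans (hbdX₂ s hs)
  have hcL0 : ∀ s t : lamSubK η U₀ L k Eb, ‖s‖ ≤ α₄ / 4 → ‖t‖ ≤ α₄ / 4 → ∀ x,
      ‖((-I) • H' (Dp (lamOf s))) x - ((-I) • H' (Dp (lamOf t))) x‖ ≤ lE * ‖s - t‖ := fun s t hs ht x => by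
    rw [← Pi.sub_apply, hsubH, Pi.smul_apply, norm_negI_smul]; exact (hH0 _ x).trans (hbdL s t hs ht)
  have hcL1 : ∀ s t : lamSubK η U₀ L k Eb, ‖s‖ ≤ α₄ / 4 → ‖t‖ ≤ α₄ / 4 → ∀ j, j ≤ k → ∀ p ∈ Eb j,
      wt L η j * ‖covDerivFwd η U₀ p.2 ((-I) • H' (Dp (lamOf s)) - (-I) • H' (Dp (lamOf t))) p.1‖ ≤ lE * ‖s - t‖ :=
    fun s t hs ht j hj p hp => by
    rw [hsubH, covDerivFwd_smul, norm_negI_smul]; exact (hH1 j hj _ p hp).trans (hbdL s t hs ht)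
  have hcL2 : ∀ s t : lamSubK η U₀ L k Eb, ‖s‖ ≤ α₄ / 4 → ‖t‖ ≤ α₄ / 4 →
      Bd2 L η k Ω (covLap η U₀ ((-I) • H' (Dp (lamOf s))) - covLap η U₀ ((-I) • H' (Dp (lamOf t)))) (lE₂ * ‖s - t‖) :=
    fun s t hs ht j hj x hx => by
    rw [Pi.sub_apply, ← covLap_sub, hsubH, covLap_smul, norm_negI_smul]; exact (hH2 _ j hj x hx).trans (hbdL₂ s t hs ht)
  -- Sect. E's (1.114) in its CONVERSE printed use: (1.79) for the inverse pair ⇒ `Q′λ_s = 0` on `𝔅_k` ⇒ the vector `Q′λ_s` vanishes (`hq`, `hq0`)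
  have hIne : (-I : ℂ) ≠ 0 := neg_ne_zero.2 Complex.I_ne_zero
  have h114q : ∀ s : lamSubK η U₀ L k Eb, ‖s‖ ≤ α₄ / 4 →
      Cond179 L k Λs U₀ (gaugeExp (lamOf s + (fun lam => (-I) • H' (Dp lam)) (lamOf s)))⁻¹ u₁⁻¹ → q (lamOf s) = 0 := by
    intro s hs hC
    have hfun : (gaugeExp (lamOf s + (-I) • H' (Dp (lamOf s))))⁻¹ = fun x => expUnit (((-I) • lamOf s - H' (Dp (lamOf s))) x) := by
      funext x
      rw [Pi.inv_apply, gaugeExp, val_inv_expUnit]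
      congr 1
      rw [Pi.add_apply, Pi.smul_apply, smul_add, smul_smul, Pi.sub_apply, Pi.smul_apply, sub_eq_add_neg,
        show (I : ℂ) * (-I) = (1 : ℂ) by rw [mul_neg, Complex.I_mul_I, neg_neg], one_smul, neg_add, ← neg_smul]
    funext j y
    by_cases hjy : j ≤ k ∧ y ∈ Λs j
    · have h1 : Qnl L U₀ (fun x => expUnit (((-I) • lamOf s - H' (Dp (lamOf s))) x)) u₁⁻¹ j y = 0 := by
        have h := hC j hjy.1 y hjy.2
        rwa [show (fun lam => (-I) • H' (Dp lam)) (lamOf s) = (-I) • H' (Dp (lamOf s)) from rfl, hfun] at h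
      rw [(hDp s hs).2.2.2.2 j hjy.1 y hjy.2] at h1
      have h2 := congrFun (QprimeIter_smul (zdBlocking d L) (bgT L U₀) (-I) (lamOf s) j) y
      rw [show ((-I) • lamOf s : Site d → 𝔸) = fun x => (-I) • lamOf s x from rfl, h2] at h1
      have h3 : QprimeIter (zdBlocking d L) (bgT L U₀) j (lamOf s) y = 0 := (smul_eq_zero.1 h1).resolve_left hIne
      rw [hq _ j hjy.1 y hjy.2, h3]
      rfl
    · rw [hq0 _ j y hjy]
      rfl
  -- r04's Prop-10 windows at 8α₄ and the local route's product window, from the Sect. E windows and `hprod8`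
  have hC6 : (0 : ℝ) ≤ C6 d := by
    have : (2 : ℝ) ≤ C6 d := by unfold C6; linarith only [one_le_C5 (d := d)]
    linarith only [this]
  have hw₁ : 10 * C6 d * (4 * (2 * α₄)) ≤ 1 := by nlinarith only [hs₁, hC6, hα₄.le]
  have hw₂ : 3000 * ((d : ℝ) + 1) * L * (4 * (2 * α₄)) ≤ 1 := by
    have e : 3000 * ((d : ℝ) + 1) * L * (4 * (2 * α₄)) = 12000 * ((d : ℝ) + 1) * L * (2 * α₄) := by ring
    rw [e]; exact hs₂
  have hprod : 2 * C6 d * (40 * d * cB + 4 * (2 * α₄)) < 1 / 2 := by nlinarith only [hprod8, hC6, hα₃, hα₄.le]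
  have hα2 : 2 * α₀ ≤ c2' d L := by linarith
  -- unitary Λ_j-witnesses for u₁ at every point of 𝔅_k (from (1.34), (1.29))
  have hwit : ∀ j, j ≤ k → ∀ y ∈ Λs j, ∃ ut : Site d → 𝔸ˣ, (∀ x, ut x ∈ unitaryUnits 𝔸) ∧
      InLambda L (clampCfg (tlo L y j) (thi L y j) U₀) ut j (40 * d * cB) (((L : ℝ) ^ j)⁻¹) ∧
      ∀ x : Site d, tlo L y j ≤ x → x ≤ thi L y j → u₁ x = ut x := fun j hj y hy =>
    witness_unitary_of_glev hd hL hU₀ hα hα3 hα4 (h33 j hj y hy) hcB hsmall hc₃ hsc hαP hαP3 hαP2 hL1 hBu (h69 j hj y hy) (hP j hj y hy)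
      (glev_on_towers_of_axial hL1 Λs hAx h129 j hj y hy)
  -- (207) at 2α₄ for −iλ′ on the towers, from the ρ-ball (ρ < 2α₄); hence (1.79) for each competitor by §1
  have hρ2 : ρ < 2 * α₄ := by linarith
  have h179_of : ∀ lam' : Site d → 𝔸, (∀ x, ‖lam' x‖ ≤ ρ) → (∀ j, j ≤ k → ∀ p ∈ Eb j, wt L η j * ‖covDerivFwd η U₀ p.2 lam' p.1‖ ≤ ρ) →
      Restr129 L k Λs U₀ (u₁ * gaugeExp lam') → Cond179 L k Λs U₀ (gaugeExp lam')⁻¹ u₁⁻¹ := by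
    intro lam' hl' hD' h129'
    have h177b : ∀ j, j ≤ k → ∀ y ∈ Λs j, ∀ x : Site d, InBox (tlo L y j) (thi L y j) x → ‖((-I) • lam') x‖ < 2 * α₄ := by
      intro j _ y _ x _
      rw [Pi.smul_apply, norm_negI_smul]
      exact (hl' x).trans_lt hρ2
    have h177a : ∀ j, j ≤ k → ∀ y ∈ Λs j, ∀ (x : Site d) (κ : Fin d), InBox (tlo L y j) (thi L y j) x →
        InBox (tlo L y j) (thi L y j) (x + e κ) → ‖cj (U₀ x κ) (((-I) • lam') (x + e κ)) - ((-I) • lam') x‖ < 2 * α₄ * ((L : ℝ) ^ j)⁻¹ := by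
      intro j hj y hy x κ hx hxe
      have hLj : (0 : ℝ) < ((L : ℝ) ^ j)⁻¹ := by
        have : (0 : ℝ) < L := by exact_mod_cast hL1
        positivity
      have hb : (x, κ) ∈ Eb j := hEbT j hj y hy x κ hx hxe
      rw [Pi.smul_apply, Pi.smul_apply, cj_smul_complex, ← smul_sub, norm_negI_smul]
      calc ‖cj (U₀ x κ) (lam' (x + e κ)) - lam' x‖ ≤ ρ * ((L : ℝ) ^ j)⁻¹ := cjDiff_le_of_weighted hL1 hη (hD' j hj (x, κ) hb)
        _ < 2 * α₄ * ((L : ℝ) ^ j)⁻¹ := mul_lt_mul_of_pos_right hρ2 hLj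
    exact cond179_gaugeExp_of_restr129_local hL hL1 hU₀ hα hα3 hα2 hα₃ (by linarith) (by positivity) h33 hwit h177b h177a hw₁ hw₂ hs₃ hs₄
      hs₅ hs₆ hprod h129 h129'
  have h179₁ := h179_of lam₁ hl₁ hD₁ h129₁
  have h179₂ := h179_of lam₂ hl₂ hD₂ h129₂
  -- the engine
  exact hFP_unique_of_cond179 hL1 hη hU₀ hΩ0 hEbΩ g Δ q qs Aw c g_left c_left' hΔ hqs (fun lam => (-I) • H' (Dp lam)) hα₄.le hBG hBR hhE
    hhE₂ hlE0 hlE0 hlE₂ hcA hcA' hcDA ha₁' hb₁' hb₁ hθ hlE hlE hρ hρ hG hRbd hc0 hc1 hc2 hcL0 hcL1 hcL2 hDA hA h103 h106 h114q hl₁ hD₁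
    hmult₁ h179₁ hl₂ hD₂ hmult₂ h179₂

end SectE

#print axioms cond179_of_restr129_mul_inv_local
#print axioms cond179_gaugeExp_of_restr129_local
#print axioms hFP_unique_of_sectE_local


end Literature.MathematicalPhysics.QuantumFieldTheory.Balaban1983to89.B8Prop5UniqSectE

end
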